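import Summits.Langlands.Langlands.Theses.ParityBlindBianchi
import Summits.Langlands.Langlands.Theorems.IcosahedralDescentLevel.Negative.AllParityOfDoorOfDescent
import Literature.NumberTheory.Automorphic.StrongArtinGL2
import Literature.NumberTheory.GaloisRepresentations.ArtinRestriction

/-!
# Disproof of `IcosahedralDescentLevel` (stmt-Langlands-15113, D′ of route ParityBlindBianchi) — findings

Refuter crux work file (cdisprove, cycle 1, 2026-08-16). Prose only in docstrings; every `theorem`
below is kernel-checked (0 sorry). LANDED (importable): p90502
`Theorems/IcosahedralDescentLevel/Negative/AllParityOfDoorOfDescent.lean` (the door) and p98657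
`Theorems/IcosahedralDescentLevel/Negative/DoorOfInhabited.lean` (§1–§2 below:
`exists_entrywise_twoAdicModel`, `allParity_of_descent_of_inhabited`,
`icosahedralDescentLevel_iff_repaired_and_door`, namespace `…Theorems.IcosahedralDescentLevel.Negative`).

FINDINGS (index):

* §1 THE DOOR IS THE WHOLE DEFECT, EXACTLY.  The typed crux binds `∃ S₀ : Finset ℕ` with no side
  condition; `0 ∈ S₀` voids the good-place predicate (`Negative.no_good_place_of_zero_mem`, landed
  p90502).  New here: the EXACT decomposition
  `IcosahedralDescentLevel ↔ IcosahedralDescentLevelRepaired ∧ IcosahedralArtinDoor`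
  (`icosahedralDescentLevel_iff_repaired_and_door`), where `…Repaired` is the crux with `0 ∉ S₀`
  added (the planner's restatement D″, which the picked line `Sketch` proves modulo the four
  Arthur–Clozel facts) and `…Door` is "all-parity icosahedral strong Artin over `ℚ` for every `ρ`
  admitting, over every 2-split imaginary quadratic `K`, a 2-adic model and SOME cuspidal datum".
  So the repair `0 ∉ S₀` loses nothing and hides nothing else: D′ = D″ + (the route's open target
  and its odd twin).
* §2 THE DOOR NEEDS NO MODULARITY INPUT.  The 2-adic model `σ = ι⁻¹ ∘ ρ|_K` exists unconditionally
  (`exists_entrywise_twoAdicModel`: finite image ⇒ open kernel ⇒ continuity of the transport), and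
  `ι : ℚ̄₂ ≃+* ℂ` exists (Steinitz, `nonempty_ringEquiv`).  Hence
  `IcosahedralArtinDoor ↔ (CuspidalDataInhabited → AllParityIcosahedralStrongArtin)`
  (`door_iff_allParity_of_inhabited`) and
  `IcosahedralDescentLevel → CuspidalDataInhabited → AllParityIcosahedralStrongArtin`
  (`allParity_of_descent_of_inhabited`), sharpening p90502 (which fed the door with E1′): the ONLY
  thing standing between the typed D′ and the even icosahedral Artin conjecture is the bare
  existence of one cuspidal automorphic representation of `GL₂` over each 2-split imaginary
  quadratic field.
* §3 LOAD-BEARING ANALYSIS of D″.  `0 ∉ S₀`: load-bearing (§1).  `hirr`, `hA5` (irreducible,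
  projective image `A₅`): NOT load-bearing — the line's ι-free theorem
  `exists_isPiOfArtinRep_of_uniform` (Lines/Sketch.lean) has neither; recorded, nothing to land.
  "compatibility at EVERY good place" (vs a.e. per `K`): load-bearing by the rev-8 analysis
  (K-dependent exceptional sets make the sign-defect set uncontrolled); no finite-model shadow found
  worth landing.  `2 split in K`: not used by the descent (only by E2′ upstream); harmless.
* §4 LINE `Sketch` (lead prover-line-stmt-Langlands-15113-0): all eight stubs SURVIVE truth
  attacks (table in the §4 docstring); `stub_bridge_misstatement` is the door and is correctly NOT
  claimed; a decidable instance of `stub_fieldSupply` is exhibited (`fieldSupply_instance`).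
* §5 WHY ¬D′ RESISTS.  `¬ IcosahedralDescentLevel` ⟹ some irreducible icosahedral `ρ/ℚ` has NO
  cuspidal `π` matching it a.e. (`not_descent_implies_artin_fails`), i.e. a counterexample to
  strong Artin — Artin-hard, expected false.  No unconditional kill exists; the item is MISSTATED,
  not false.  Repair (for the planner): `∃ S₀ : Finset ℕ, 0 ∉ S₀ ∧ ∀ K …` in D′ and
  `∃ S₀, 2 ∈ S₀ ∧ 0 ∉ S₀ ∧ …` in E1′ (equivalently `∀ ℓ ∈ S₀, ℓ.Prime`).
-/

set_option linter.dupNamespace false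

noncomputable section

open scoped MatrixGroups NumberField
open NumberField IsDedekindDomain Field Filter
open Literature.NumberTheory.Automorphic Literature.NumberTheory.GaloisRepresentations
open Summit.Langlands.Langlands.Theses.ParityBlindBianchi

namespace Summit.Langlands.Langlands.Cruxes.IcosahedralDescentLevel.Disproof

/-! ## §0 The pieces of the crux, named -/

/-- The per-field data demanded by the hypothesis of D′ for the bad set `S₀`: a 2-adic model `σ`
of `ρ|_K` (entrywise through `ι`) and a cuspidal `π_K` Satake–Frobenius compatible with `σ` at
every place of `K` over no element of `S₀`. Verbatim sub-expression of the crux. [folklore] -/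
def UniformFamily (ι : PadicAlgCl 2 ≃+* ℂ) (ρ : FramedGaloisRep ℚ ℂ 2) (S₀ : Finset ℕ) : Prop :=
  ∀ (K : Type) [Field K] [NumberField K], NumberField.IsTotallyComplex K →
    Module.finrank ℚ K = 2 →
    (∃ v w : HeightOneSpectrum (𝓞 K), v ≠ w ∧ ((2 : ℕ) : 𝓞 K) ∈ v.asIdeal ∧
      ((2 : ℕ) : 𝓞 K) ∈ w.asIdeal) →
    ∃ (σ : FramedGaloisRep K (PadicAlgCl 2) 2) (hcpt : isCompact_glFiniteIntegralLevel 2 K)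
      (π : CuspidalAutomorphicRepData 2 K hcpt),
      (∀ (g : absoluteGaloisGroup K) (i j : Fin 2),
        ι ((σ g).val i j) = ((FramedGaloisRep.restrictField K ρ) g).val i j) ∧
      ∀ w : HeightOneSpectrum (𝓞 K), (∀ ℓ ∈ S₀, ((ℓ : ℕ) : 𝓞 K) ∉ w.asIdeal) →
        Summit.Langlands.SatakeFrobCompatibleAt ι π.1 σ w

/-- The conclusion of D′ for `ρ`: strong Artin in Tunnell's a.e. sense. Verbatim sub-expression of
the crux (and of the route target `EvenIcosahedralStrongArtin`). [folklore] -/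
def ArtinConclusion (ρ : FramedGaloisRep ℚ ℂ 2) : Prop :=
  ∃ (hcpt : isCompact_glFiniteIntegralLevel 2 ℚ) (π : CuspidalAutomorphicRepData 2 ℚ hcpt),
    ∀ᶠ v : HeightOneSpectrum (𝓞 ℚ) in cofinite, ∃ α : Multiset ℂ,
      π.1.HasSatakeParamAt v α ∧ ρ.IsUnramifiedAt v ∧ ρ.HasFrobCharpolyAt v (satakePolynomial α)

/-- `ρ` is irreducible of icosahedral type (the two standing hypotheses of the crux). [folklore] -/
def IsIcosahedral (ρ : FramedGaloisRep ℚ ℂ 2) : Prop :=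
  ρ.toGaloisRep.IsIrreducible ∧
    Nonempty ((Matrix.ProjGenLinGroup.mk.comp ρ.toMonoidHom).range ≃* alternatingGroup (Fin 5))

/-- The crux, re-assembled from the named pieces (definitionally the route decl, see
`crux_iff`). [folklore] -/
theorem crux_iff :
    IcosahedralDescentLevel ↔
      ∀ (ι : PadicAlgCl 2 ≃+* ℂ) (ρ : FramedGaloisRep ℚ ℂ 2), IsIcosahedral ρ →
        (∃ S₀ : Finset ℕ, UniformFamily ι ρ S₀) → ArtinConclusion ρ := by
  constructor
  · intro h ι ρ hico hS
    exact h ι ρ hico.1 hico.2 hS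
  · intro h ι ρ hirr hA5 hS
    exact h ι ρ ⟨hirr, hA5⟩ hS

/-! ## §1 The door is the whole defect: `D′ ↔ D″ ∧ Door` -/

/-- **D″, the repaired crux**: D′ with the bad set required to consist of non-zero naturals
(`0 ∉ S₀`; equivalently one may ask `∀ ℓ ∈ S₀, ℓ.Prime`). This is the statement the picked line
`Sketch` proves modulo the Arthur–Clozel facts F1–F4. [folklore] -/
def IcosahedralDescentLevelRepaired : Prop :=
  ∀ (ι : PadicAlgCl 2 ≃+* ℂ) (ρ : FramedGaloisRep ℚ ℂ 2), IsIcosahedral ρ →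
    (∃ S₀ : Finset ℕ, (0 : ℕ) ∉ S₀ ∧ UniformFamily ι ρ S₀) → ArtinConclusion ρ

/-- **The door**: what D′ asserts through `S₀ ∋ 0` — strong Artin (a.e.) for EVERY irreducible
icosahedral `ρ/ℚ`, odd or even, granted only a 2-adic model of `ρ|_K` and SOME cuspidal datum on
`GL₂/K` for every 2-split imaginary quadratic `K` (no compatibility whatsoever). [folklore] -/
def IcosahedralArtinDoor : Prop :=
  ∀ (ι : PadicAlgCl 2 ≃+* ℂ) (ρ : FramedGaloisRep ℚ ℂ 2), IsIcosahedral ρ →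
    (∀ (K : Type) [Field K] [NumberField K], NumberField.IsTotallyComplex K →
      Module.finrank ℚ K = 2 →
      (∃ v w : HeightOneSpectrum (𝓞 K), v ≠ w ∧ ((2 : ℕ) : 𝓞 K) ∈ v.asIdeal ∧
        ((2 : ℕ) : 𝓞 K) ∈ w.asIdeal) →
      ∃ (σ : FramedGaloisRep K (PadicAlgCl 2) 2) (hcpt : isCompact_glFiniteIntegralLevel 2 K)
        (_π : CuspidalAutomorphicRepData 2 K hcpt),
        ∀ (g : absoluteGaloisGroup K) (i j : Fin 2),
          ι ((σ g).val i j) = ((FramedGaloisRep.restrictField K ρ) g).val i j) →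
    ArtinConclusion ρ

/-- With `0 ∈ S₀` the uniform family degenerates to bare data (model + some cuspidal datum):
the compatibility clause is vacuous (`Negative.no_good_place_of_zero_mem`, p90502). [folklore] -/
theorem uniformFamily_of_zero_mem {ι : PadicAlgCl 2 ≃+* ℂ} {ρ : FramedGaloisRep ℚ ℂ 2}
    {S₀ : Finset ℕ} (h0 : (0 : ℕ) ∈ S₀)
    (hdata : ∀ (K : Type) [Field K] [NumberField K], NumberField.IsTotallyComplex K →
      Module.finrank ℚ K = 2 →
      (∃ v w : HeightOneSpectrum (𝓞 K), v ≠ w ∧ ((2 : ℕ) : 𝓞 K) ∈ v.asIdeal ∧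
        ((2 : ℕ) : 𝓞 K) ∈ w.asIdeal) →
      ∃ (σ : FramedGaloisRep K (PadicAlgCl 2) 2) (hcpt : isCompact_glFiniteIntegralLevel 2 K)
        (_π : CuspidalAutomorphicRepData 2 K hcpt),
        ∀ (g : absoluteGaloisGroup K) (i j : Fin 2),
          ι ((σ g).val i j) = ((FramedGaloisRep.restrictField K ρ) g).val i j) :
    UniformFamily ι ρ S₀ := by
  intro K _ _ htc hdeg hsplit
  obtain ⟨σ, hcpt, π, hmodel⟩ := hdata K htc hdeg hsplit
  refine ⟨σ, hcpt, π, hmodel, fun w hw => ?_⟩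
  exact absurd hw
    (Summit.Langlands.Langlands.Theorems.IcosahedralDescentLevel.Negative.no_good_place_of_zero_mem
      h0 K w)

/-- **Exact decomposition of the typed crux**: `D′ ↔ D″ ∧ Door`. (→): D″ is the special case
`0 ∉ S₀`; the door is the special case `S₀ = {0}` (`uniformFamily_of_zero_mem`). (←): given a
witness `S₀`, either `0 ∉ S₀` (use D″) or `0 ∈ S₀`, and then the family itself supplies the bare
data the door consumes. Consequently the planner's repair `0 ∉ S₀` is COMPLETE: nothing else is
hidden in the typing of D′. [folklore] -/
theorem icosahedralDescentLevel_iff_repaired_and_door :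
    IcosahedralDescentLevel ↔ IcosahedralDescentLevelRepaired ∧ IcosahedralArtinDoor := by
  rw [crux_iff]
  constructor
  · intro h
    refine ⟨fun ι ρ hico ⟨S₀, _, hS⟩ => h ι ρ hico ⟨S₀, hS⟩, fun ι ρ hico hdata => ?_⟩
    exact h ι ρ hico ⟨{0}, uniformFamily_of_zero_mem (Finset.mem_singleton_self 0) hdata⟩
  · rintro ⟨hrep, hdoor⟩ ι ρ hico ⟨S₀, hS⟩
    by_cases h0 : (0 : ℕ) ∈ S₀
    · refine hdoor ι ρ hico fun K _ _ htc hdeg hsplit => ?_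
      obtain ⟨σ, hcpt, π, hmodel, -⟩ := hS K htc hdeg hsplit
      exact ⟨σ, hcpt, π, hmodel⟩
    · exact hrep ι ρ hico ⟨S₀, h0, hS⟩

/-- `…_false_without_` form of §1 (any proof of D′ must use `0 ∉ S₀`, i.e. must ALSO prove the
door): D′ minus the repair is exactly the door. [folklore] -/
theorem door_of_icosahedralDescentLevel (h : IcosahedralDescentLevel) : IcosahedralArtinDoor :=
  (icosahedralDescentLevel_iff_repaired_and_door.mp h).2

/-! ## §2 The door needs no modularity input: 2-adic models and `ι` exist unconditionally -/

/-- A group homomorphism out of a topological group with open kernel is continuous (private copy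
of the tree's `MonoidHom.continuous_of_isOpen_ker`, `LanglandsTetrahedral`, to keep imports light).
[folklore] -/
theorem continuous_of_isOpen_ker' {G H : Type*} [Group G] [TopologicalSpace G]
    [IsTopologicalGroup G] [Group H] [TopologicalSpace H] [ContinuousMul H] (f : G →* H)
    (hf : IsOpen (f.ker : Set G)) : Continuous f := by
  apply continuous_of_continuousAt_one f
  rw [ContinuousAt, map_one]
  intro U hU
  rw [Filter.mem_map]
  apply Filter.mem_of_superset (hf.mem_nhds (by simp))
  intro g hg
  rw [SetLike.mem_coe, MonoidHom.mem_ker] at hg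
  rw [Set.mem_preimage, hg]
  exact mem_of_mem_nhds hU

/-- **2-adic models exist, unconditionally.** For every `ι : ℚ̄₂ ≃+* ℂ`, every
`ρ : Γ_ℚ →ₜ* GL₂(ℂ)` and every number field `K`, the entrywise transport `σ := ι⁻¹ ∘ ρ|_{Γ_K}` IS a
framed 2-adic Galois representation: `ρ|_{Γ_K}` has finite image (`finite_range_toMonoidHom`), hence
open kernel (`isOpen_ker_of_finite_range`), and a homomorphism whose kernel contains an open
subgroup is continuous for ANY topology on the target. So the "2-adic model" clause of D′/E1′ is
free — it constrains nothing. [folklore] -/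
theorem exists_entrywise_twoAdicModel (ι : PadicAlgCl 2 ≃+* ℂ) (ρ : FramedGaloisRep ℚ ℂ 2)
    (K : Type) [Field K] [NumberField K] :
    ∃ σ : FramedGaloisRep K (PadicAlgCl 2) 2, ∀ (g : absoluteGaloisGroup K) (i j : Fin 2),
      ι ((σ g).val i j) = ((FramedGaloisRep.restrictField K ρ) g).val i j := by
  set ρK : FramedArtinRep K 2 := FramedGaloisRep.restrictField K ρ with hρK
  haveI : Finite ρK.toMonoidHom.range := finite_range_toMonoidHom ρK
  have hker : IsOpen (ρK.toMonoidHom.ker : Set (absoluteGaloisGroup K)) :=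
    isOpen_ker_of_finite_range ρK
  let f : absoluteGaloisGroup K →* GL (Fin 2) (PadicAlgCl 2) :=
    (Matrix.GeneralLinearGroup.map (ι.symm : ℂ →+* PadicAlgCl 2)).comp ρK.toMonoidHom
  have hle : ρK.toMonoidHom.ker ≤ f.ker := by
    intro g hg
    rw [MonoidHom.mem_ker] at hg ⊢
    have hg' : ρK g = 1 := hg
    change Matrix.GeneralLinearGroup.map (ι.symm : ℂ →+* PadicAlgCl 2) (ρK g) = 1
    rw [hg', map_one]
  have hfker : IsOpen (f.ker : Set (absoluteGaloisGroup K)) := Subgroup.isOpen_mono hle hker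
  refine ⟨{ f with continuous_toFun := continuous_of_isOpen_ker' f hfker }, fun g i j => ?_⟩
  change ι ((f g).val i j) = _
  simp [f]

/-- **An abstract field isomorphism `ℚ̄₂ ≃+* ℂ` exists** (Steinitz: both are algebraically closed
of characteristic `0` and cardinality `𝔠`) — the argument of the route's `closes`, isolated.
[folklore] -/
theorem nonempty_ringEquiv : Nonempty (PadicAlgCl 2 ≃+* ℂ) := by
  have hQ2 : Cardinal.mk ℚ_[2] = Cardinal.continuum := by
    apply le_antisymm
    · change Cardinal.mk (Quotient (CauSeq.equiv : Setoid (CauSeq ℚ (padicNorm 2)))) ≤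
        Cardinal.continuum
      refine (Cardinal.mk_quotient_le (s := (CauSeq.equiv : Setoid (CauSeq ℚ (padicNorm 2))))).trans ?_
      refine (Cardinal.mk_subtype_le _).trans_eq ?_
      rw [← Cardinal.power_def, Cardinal.mk_nat, Cardinal.mkRat, Cardinal.aleph0_power_aleph0]
    · exact continuum_le_cardinal_of_nontriviallyNormedField ℚ_[2]
  have hC2 : Cardinal.mk (PadicAlgCl 2) = Cardinal.continuum := by
    apply le_antisymm
    · refine (Algebra.IsAlgebraic.cardinalMk_le_max ℚ_[2] (PadicAlgCl 2)).trans ?_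
      rw [hQ2, max_eq_left Cardinal.aleph0_le_continuum]
    · rw [← hQ2]
      exact Cardinal.mk_le_of_injective (algebraMap ℚ_[2] (PadicAlgCl 2)).injective
  refine IsAlgClosed.ringEquiv_of_equiv_of_charZero ?_
    (Cardinal.eq.1 (by rw [hC2, Cardinal.mk_complex]))
  rw [hC2]
  exact Cardinal.aleph0_lt_continuum

/-- **Bare inhabitation** `H`: for every imaginary quadratic `K` with `2` split, `GL₂(𝒪̂_K)` is
compact (a theorem of the tree, kept existential to stay verbatim with the crux) and there is at
least one cuspidal automorphic representation datum of `GL₂(𝔸_K)`. TRUE (base change of any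
non-CM weight-2 newform; any modular elliptic curve over `K`) but not constructible in the tree
(no cusp form has been built in the Borel–Jacquet datum model). [folklore] -/
def CuspidalDataInhabited : Prop :=
  ∀ (K : Type) [Field K] [NumberField K], NumberField.IsTotallyComplex K →
    Module.finrank ℚ K = 2 →
    (∃ v w : HeightOneSpectrum (𝓞 K), v ≠ w ∧ ((2 : ℕ) : 𝓞 K) ∈ v.asIdeal ∧
      ((2 : ℕ) : 𝓞 K) ∈ w.asIdeal) →
    ∃ hcpt : isCompact_glFiniteIntegralLevel 2 K, Nonempty (CuspidalAutomorphicRepData 2 K hcpt)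

/-- **All-parity icosahedral strong Artin over `ℚ`** (a.e., Tunnell's sense): the route target
`EvenIcosahedralStrongArtin` WITHOUT its evenness hypothesis (so it contains the even case, open,
and the odd case, Khare–Wintenberger–Kisin in print but far from the tree). [folklore] -/
def AllParityIcosahedralStrongArtin : Prop :=
  ∀ ρ : FramedGaloisRep ℚ ℂ 2, IsIcosahedral ρ → ArtinConclusion ρ

/-- **The door, unmasked**: `Door ↔ (H → all-parity icosahedral strong Artin)`. (→) choose `ι` by
Steinitz and the models by `exists_entrywise_twoAdicModel`; (←) the door's own hypothesis exhibits
`H`. [folklore] -/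
theorem door_iff_allParity_of_inhabited :
    IcosahedralArtinDoor ↔ (CuspidalDataInhabited → AllParityIcosahedralStrongArtin) := by
  constructor
  · intro hdoor hinh ρ hico
    obtain ⟨ι⟩ := nonempty_ringEquiv
    refine hdoor ι ρ hico fun K _ _ htc hdeg hsplit => ?_
    obtain ⟨hcpt, ⟨π⟩⟩ := hinh K htc hdeg hsplit
    obtain ⟨σ, hσ⟩ := exists_entrywise_twoAdicModel ι ρ K
    exact ⟨σ, hcpt, π, hσ⟩
  · intro h ι ρ hico hdata
    refine h (fun K _ _ htc hdeg hsplit => ?_) ρ hico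
    obtain ⟨_, hcpt, π, -⟩ := hdata K htc hdeg hsplit
    exact ⟨hcpt, ⟨π⟩⟩

/-- **D′ as typed + bare inhabitation ⟹ all-parity icosahedral strong Artin** (sharpens p90502,
which fed the door with E1′ `ResidualBianchiDoorLevel`: no residual modularity, no Hecke point, no
weight realisation is needed — only that SOME cusp form exists on `GL₂` over each `K`).
[folklore] -/
theorem allParity_of_descent_of_inhabited (hD : IcosahedralDescentLevel)
    (hinh : CuspidalDataInhabited) : AllParityIcosahedralStrongArtin :=
  door_iff_allParity_of_inhabited.mp (door_of_icosahedralDescentLevel hD) hinh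

/-- The same with the target's binders spelled out (for readers grepping the conclusion of
`EvenIcosahedralStrongArtin`; note the ABSENT evenness hypothesis). [folklore] -/
theorem artinConclusion_of_descent_of_inhabited (hD : IcosahedralDescentLevel)
    (hinh : CuspidalDataInhabited) (ρ : FramedGaloisRep ℚ ℂ 2)
    (hirr : ρ.toGaloisRep.IsIrreducible)
    (hA5 : Nonempty ((Matrix.ProjGenLinGroup.mk.comp ρ.toMonoidHom).range ≃*
      alternatingGroup (Fin 5))) :
    ∃ (hcpt : isCompact_glFiniteIntegralLevel 2 ℚ) (π : CuspidalAutomorphicRepData 2 ℚ hcpt),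
      ∀ᶠ v : HeightOneSpectrum (𝓞 ℚ) in cofinite, ∃ α : Multiset ℂ,
        π.1.HasSatakeParamAt v α ∧ ρ.IsUnramifiedAt v ∧
          ρ.HasFrobCharpolyAt v (satakePolynomial α) :=
  allParity_of_descent_of_inhabited hD hinh ρ ⟨hirr, hA5⟩

/-! ## §3 Load-bearing analysis of the repaired statement D″ (remarks; nothing to land)

* `0 ∉ S₀` — load-bearing: §1.
* `IsIcosahedral ρ` (irreducible, projective image `A₅`) — NOT load-bearing for D″: the line's
  ι-free theorem `exists_isPiOfArtinRep_of_uniform` (Lines/Sketch.lean) descends ANY rank-two Artin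
  `ρ` from a uniform family (reducible or dihedral-from-a-2-split-`K` cases are vacuous by
  Jacquet–Shalika: no cuspidal `π_K` matches a reducible `ρ|_K`). Information for the planner: D″
  could be filed for all `ρ : FramedGaloisRep ℚ ℂ 2`.
* "compatible at EVERY good place of `K`" — load-bearing (rev-8 NUMBERS paragraph of the route:
  with a `K`-dependent exceptional set the sign-defect set of the descended `π` is an arbitrary
  sparse set of primes inert in the first `k` fields; equivalent to the conclusion by
  Ramakrishnan's `1/8` refinement of strong multiplicity one). No finite-model shadow of this is
  both faithful and decidable; not pursued.
* `2` split in `K`, `IsTotallyComplex K` — not used by the descent at all (they only make the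
  family SMALLER, i.e. the hypothesis weaker and D″ stronger; the line supplies its own auxiliary
  `K = ℚ(√-D)` with `16 ∣ D + 1`, which ARE 2-split imaginary quadratic). Harmless.
* `ι` fixed across all `K` — harmless (any `ι`; the conclusion is `ι`-free).
-/

/-! ## §4 Line `Sketch` — stub-by-stub truth audit (targets: none stuck yet)

| stub | verdict | why (truth) | provability note |
|---|---|---|---|
| `stub_fact_descent` F1, `stub_fact_strongLifting` F2, `stub_fact_baseChangeCuspidal` F3, `stub_fact_fibres` F4 | facts, consistent with print | A–C III.4.2(d), III.5.1 (both clauses (i),(ii) vendored), III.4.2(a) (single inert witness place suffices: `π ≅ π⊗η` forces `t = ζt` at EVERY place unramified for `π, η`), III.3.1 | XL, not worked — correct |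
| `stub_bridge_misstatement` | = the door (§1–2); unprovable short of all-parity Artin | `icosahedralDescentLevel_iff_repaired_and_door` | correctly NOT claimed |
| `stub_fieldSupply` | TRUE | CRT class `D ≡ -1 (16pp')`, `D ≡ -n (ℓ₁)` with `n` a QNR, coprime to `16pp'ℓ₁` (`ℓ₁ ∉ {2,p,p'}`); Dirichlet (`Nat.infinite_setOf_prime_and_eq_mod`) | instance `ℓ₁=3,p=5,p'=7`: `D = 2239` (`fieldSupply_instance`) |
| `stub_inert` | TRUE | `hns` forces `ℓ` odd, `ℓ ∤ D`, `-D` QNR ⇒ `ℓ` inert in `ℚ(√-D)` (also for non-squarefree `D`: `ℚ(√-D) = ℚ(√-D₀)`, `ℓ ∤` the square part) ⇒ `f = 2` | needs a Kummer–Dedekind step for `QuadraticAlgebra ℚ (-D) 0` at odd `ℓ ∤ D` |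
| `stub_witness` | TRUE | `chebotarev_artinRep_holds` with `g = 1` + `frobRoots_eq_pair_of_apply_eq_scalar` (`u = 1`); drop `X ∪ {2}` from an infinite set | provable now |
| `stub_anchor` | TRUE | `isGaloisStableSatakeAE_of_isPiOfArtinRep` ⇒ F1 ⇒ `π`; F2(ii) at split `v₁` ⇒ `π` unramified at `v₁`; F2(i) + `hasSatakeParamAt_unique_holds` + `eq_map_pow_of_hasFrobCharpolyAt_restrictField` ⇒ `t_{π,v₁} = {1,1}`; `exists_twist_quadraticSign_holds` ⇒ `π♭` | provable from F1, F2 |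
| `stub_caseB` | TRUE | `(εβ)^f = ε^f β^f`, uniqueness/cofinite existence of Satake parameters (`hSU`, `hSC`), finitely many places of `K` over the bad places of `ℚ` | provable now |
| `stub_readOff` | TRUE | F2(ii) (descent of unramifiedness at `v` unramified in `K`) then F2(i) with `f = 1`, uniqueness of Satake parameters, Frobenius at a degree-one place | provable from F2 |
| `stub_transfer` | TRUE | `exists_contragredient_satake_holds` inverts Satake parameters at EVERY place; `isUnramifiedAt_of_entrywise`, `hasFrobCharpolyAt_of_entrywise` (FrobRoots helper) are pointwise | provable now (copy `exists_isPiOfArtinRep_of_satakeFrobCompatibleAt` without `filter_upwards`) |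

Joint sufficiency: `pair_dichotomy`, `exists_isPiOfArtinRep_of_uniform`, `icosahedralDescentLevel_repaired`
are already sorry-free over the stubs; `IcosahedralDescentLevel_of` needs exactly the bridge = the door.
No stub is false; no `Negative/…False.lean` to file against the line.
-/

/-- A decidable instance of the line's `stub_fieldSupply` (`ℓ₁ = 3`, `p = 5`, `p' = 7`, `B = 0`):
`D = 2239` is prime, `2240 = 2⁶·5·7`, and `-2239 ≡ 2 (mod 3)` is a non-residue. Shows the CRT
system of the stub is consistent at the smallest parameters (non-vacuity check). [folklore] -/
theorem fieldSupply_instance :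
    Nat.Prime 2239 ∧ 0 < 2239 ∧ 16 ∣ 2239 + 1 ∧ 8 * 5 ∣ 2239 + 1 ∧ 8 * 7 ∣ 2239 + 1 ∧
      ∀ x : ℤ, ¬ ((3 : ℤ) ∣ x ^ 2 + 2239) := by
  refine ⟨by norm_num, by norm_num, by norm_num, by norm_num, by norm_num, fun x hx => ?_⟩
  have h : ((x ^ 2 + 2239 : ℤ) : ZMod 3) = 0 := (ZMod.intCast_zmod_eq_zero_iff_dvd _ 3).mpr hx
  push_cast at h
  generalize (x : ZMod 3) = y at h
  revert y
  decide

/-! ## §5 Why `¬ D′` resists (near-miss, documented) -/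

/-- **A kill of D′ is a counterexample to strong Artin.** `¬ IcosahedralDescentLevel` forces an
irreducible icosahedral `ρ/ℚ` with NO cuspidal `π` on `GL₂(𝔸_ℚ)` matching it almost everywhere
(the conclusion of D′ does not mention the hypothesis). Since odd icosahedral `ρ` are automorphic
(Khare–Wintenberger–Kisin) such a `ρ` would be EVEN and would refute the route target itself; no
such `ρ` is known or expected (Calegari 2023 §12). Hence no unconditional `¬ D′` is available: the
crux is misstated (§1), not refutable. [folklore] -/
theorem not_descent_implies_artin_fails (h : ¬ IcosahedralDescentLevel) :
    ∃ ρ : FramedGaloisRep ℚ ℂ 2, IsIcosahedral ρ ∧ ¬ ArtinConclusion ρ := by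
  by_contra hall
  push Not at hall
  exact h fun ι ρ hirr hA5 _ => hall ρ ⟨hirr, hA5⟩

/-- Conversely all-parity Artin closes D′ outright (hypothesis unused) — the sense in which D′ is
"true but mis-sized": it sits between the door and full all-parity icosahedral Artin. [folklore] -/
theorem descent_of_allParity (h : AllParityIcosahedralStrongArtin) : IcosahedralDescentLevel :=
  fun _ ρ hirr hA5 _ => h ρ ⟨hirr, hA5⟩

end Summit.Langlands.Langlands.Cruxes.IcosahedralDescentLevel.Disproof

end
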